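import Literature.Claims.NS.Vukolov2026
import Literature.Analysis.FluidPDE.AxisymHouLiVariables
import Mathlib.Analysis.Calculus.BumpFunction.InnerProduct
import HarnessLib
import Literature.Uncategorized.StepC23RankLeTwo

/-!
# C170 `Vukolov2026` — refuter-of-record kit (ns-claims-refuter-5 g4): the rank trichotomy that feeds
# Theorem 9.6 is not exhaustive

D-0090 NS-CLAIMS SWEEP, cell `ns-claims`, claim C170 (RULINGS v1.45); skeleton
`Literature.Claims.NS.Vukolov2026` (ns-claims-typist-1 g6, p547441, sha16 `c073eb15ee2f0f4f`, 580 l.); text of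
record Zenodo 18702245 v3 «Evolutionary Gauges and the Global Regularity Problem for the Three-Dimensional
Navier–Stokes Equations», sha16 `bd3eadae84e0ecf0`, 92 pp. («p.N l.M» = line M of `pNNN.txt` of the census pin).

**Where the typed chain breaks.** The composition of record `claim_of_steps (hC23 : Step_C23) (h67 : Step_67)
(h94 : Step_94) (h0 : Step_rank0)` (§10.2 Steps 1–5 p.35 l.23–40; Thm 9.6 proof p.34 l.10–11 «For rank-2
fields, this is Theorem 6.7. For rank-1 fields, this is Theorem 9.4. For rank-0 fields, it is trivial»)
consumes FIRST the exhaustiveness of the three cases, Corollary 2.3 p.10 l.44–46, typed VERBATIM as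
`Step_C23`: «For a smooth divergence-free field V that is not of the form αe with e · ∇e = 0, and not
constant, we have rank(∇V) = 2 on an open dense subset of its domain.» This kit records, Theorems-side and by
name against the landed skeleton, that `Step_C23` is FALSE in the kernel:

* `not_Step_C23` — the explicit smooth divergence-free field on ℝ³
  `V(x) = ∂z + χ(x₂) · (−x₁, x₀, 0)` (`χ` a smooth bump in the height `x₂ = z`: `χ = 1` for `|z| ≤ 1`,
  `χ = 0` for `|z| ≥ 2`; a uniform stream carrying a slab of rigid swirl) is a datum of the typed class
  (`IsDatum`: `C^∞`, `div V = 0`), is NOT of the form `α e` with `‖e‖ = 1`, `(e·∇)e = 0` (`Vmix_not_rank1Form`: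
  for such fields `(V·∇)V ∥ V` wherever `V ≠ 0`, `convect_parallel`, while at `p = ½∂x` one has
  `(V·∇)V = −½∂x ∦ V(p) = ∂z + ½∂y`), is NOT constant, and yet `rank ∇V = 0` on the open half-space `{z > 2}`,
  so `rank ∇V = 2` holds on NO open dense set (`Vmix_not_rank2`);
* the witness has `rank ∇V ≤ 2` EVERYWHERE (`Vmix_jacRank_le_two`), i.e. it satisfies Theorem 2.1's standing
  hypothesis «det(∇V) ≡ 0» (p.10 l.31–34), so restoring that hypothesis to Cor 2.3 does not rescue it
  (`not_Step_C23_rankLeTwo`, the charitable re-typing, refuter-typed and labelled as such);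
* consequently the printed three-case proof of Theorem 9.6 (`step96_of_cases`) does not cover the typed data
  class: `cases_not_exhaustive` exhibits a smooth divergence-free field in none of the three printed classes
  (mixed rank: 2 on the slab `|z| < 1`, 0 above `z = 2`);
* RECORDS for the chair's lettering (no verdict implied here): binders 2 and 3 unfold, by the skeleton's own
  `inA_iff_globalSol` (Def 2.6 p.12 l.22–27 as typed), to the claimed theorem restricted to the rank-2 /
  rank-1 classes (`step67_iff_claim_on_rank2`, `step94_iff_claim_on_rank1`), and the skeleton's
  `step96_iff_claimedTheorem` (p547441) is re-exported by name (`step96_iff_claimedTheorem'`).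

All statements are the landed declarations BY NAME; nothing is re-typed except the explicitly labelled
charitable variant `Step_C23_rankLeTwo`. Standard axioms only.

WHAT THIS IS NOT: not a claim about NS regularity or blow-up; not a claim about any author beyond the typed
locator.
-/

set_option linter.dupNamespace false

noncomputable section

open Set Function Module Filter
open scoped ContDiff Topology

namespace Summit.NavierStokesRegularity.NavierStokesRegularity.Theorems.Vukolov2026

open Literature.Analysis Literature.Analysis.FluidPDE Literature.Claims.NS.ClayVariants
open Literature.Claims.NS.Vukolov2026

/-! ## The witness `V(x) = ∂z + χ(z)·(−y, x, 0)` -/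

/-- The standard basis vector `∂ᵢ` of ℝ³. -/
abbrev bv (i : Fin 3) : E3 := EuclideanSpace.single i (1 : ℝ)

/-- The rotation generator `J x = (−x₁, x₀, 0)` (rigid swirl about the `z`-axis), as a continuous linear map. -/
def Jrot : E3 →L[ℝ] E3 :=
  -((EuclideanSpace.proj (1 : Fin 3) : E3 →L[ℝ] ℝ).smulRight (bv 0)) +
    (EuclideanSpace.proj (0 : Fin 3) : E3 →L[ℝ] ℝ).smulRight (bv 1)

/-- `J x = −x₁ ∂x + x₀ ∂y`. -/
theorem Jrot_apply (x : E3) : Jrot x = -((x 1) • bv 0) + (x 0) • bv 1 := by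
  simp [Jrot]

/-- Coordinates of `J x`. -/
@[simp] theorem Jrot_apply_zero (x : E3) : Jrot x 0 = -(x 1) := by simp [Jrot_apply]
/-- Coordinates of `J x`. -/
@[simp] theorem Jrot_apply_one (x : E3) : Jrot x 1 = x 0 := by simp [Jrot_apply]
/-- Coordinates of `J x`. -/
@[simp] theorem Jrot_apply_two (x : E3) : Jrot x 2 = 0 := by simp [Jrot_apply]

/-- `J x` lies in the horizontal plane `span {∂x, ∂y}`. -/
theorem Jrot_mem_span (x : E3) : Jrot x ∈ Submodule.span ℝ ({bv 0, bv 1} : Set E3) := by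
  rw [Jrot_apply]
  refine Submodule.add_mem _ (Submodule.neg_mem _ (Submodule.smul_mem _ _ ?_))
    (Submodule.smul_mem _ _ ?_)
  · exact Submodule.subset_span (by simp)
  · exact Submodule.subset_span (by simp)

/-- The height cut-off: a smooth bump `χ` on ℝ with `χ = 1` on `[-1, 1]` and `χ = 0` outside `(-2, 2)`. -/
def cut : ContDiffBump (0 : ℝ) := ⟨1, 2, one_pos, one_lt_two⟩

/-- `χ(s) = 1` for `|s| ≤ 1`. -/
theorem cut_eq_one {s : ℝ} (hs : |s| ≤ 1) : (cut : ℝ → ℝ) s = 1 :=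
  cut.one_of_mem_closedBall (by simpa [cut, Real.dist_eq] using hs)

/-- `χ(s) = 0` for `|s| ≥ 2`. -/
theorem cut_eq_zero {s : ℝ} (hs : 2 ≤ |s|) : (cut : ℝ → ℝ) s = 0 :=
  cut.zero_of_le_dist (by simpa [cut, Real.dist_eq] using hs)

/-- The height coordinate `x ↦ x₂ = z` as a continuous linear map. -/
abbrev pz : E3 →L[ℝ] ℝ := EuclideanSpace.proj (2 : Fin 3)

/-- **The witness**: `V(x) = ∂z + χ(x₂) · J x` — the uniform stream `∂z` carrying a slab `|z| ≤ 2` of rigid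
swirl, smoothly cut off in the height. -/
def Vmix : E3 → E3 := fun x => bv 2 + (cut : ℝ → ℝ) (x 2) • Jrot x

/-- The vertical component of the witness is identically `1` (in particular `V` vanishes nowhere). -/
theorem Vmix_apply_two (x : E3) : Vmix x 2 = 1 := by simp [Vmix]

/-- The cut-off factor `x ↦ χ(x₂)` is smooth. -/
theorem contDiff_cutz : ContDiff ℝ ∞ (fun x : E3 => (cut : ℝ → ℝ) (x 2)) :=
  cut.contDiff.comp (pz : E3 →L[ℝ] ℝ).contDiff

/-- The witness is `C^∞`. -/
theorem Vmix_contDiff : ContDiff ℝ ∞ Vmix :=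
  contDiff_const.add (contDiff_cutz.smul (Jrot : E3 →L[ℝ] E3).contDiff)

/-- Derivative of the cut-off factor: `d(χ∘z)(x) = χ'(x₂) dz`. -/
theorem hasFDerivAt_cutz (x : E3) :
    HasFDerivAt (fun y : E3 => (cut : ℝ → ℝ) (y 2)) (deriv (cut : ℝ → ℝ) (x 2) • (pz : E3 →L[ℝ] ℝ)) x := by
  have hd : HasDerivAt (cut : ℝ → ℝ) (deriv (cut : ℝ → ℝ) (x 2)) ((pz : E3 →L[ℝ] ℝ) x) :=
    ((cut.contDiff (n := ⊤)).differentiable (by simp)).differentiableAt.hasDerivAt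
  exact hd.comp_hasFDerivAt x (pz : E3 →L[ℝ] ℝ).hasFDerivAt

/-- **The Jacobian of the witness**: `∇V(x) = χ(x₂) J + χ'(x₂) (J x) ⊗ dz`. -/
theorem hasFDerivAt_Vmix (x : E3) :
    HasFDerivAt Vmix ((cut : ℝ → ℝ) (x 2) • (Jrot : E3 →L[ℝ] E3) +
      (deriv (cut : ℝ → ℝ) (x 2) • (pz : E3 →L[ℝ] ℝ)).smulRight (Jrot x)) x :=
  ((hasFDerivAt_cutz x).smul (Jrot : E3 →L[ℝ] E3).hasFDerivAt).const_add (bv 2)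

/-- The witness is divergence free: `div V = χ · tr J + χ'(z) (J x)₂ = 0 + 0`. -/
theorem Vmix_divFree : NSWave0.IsDivFree Vmix := by
  intro x
  show VectorCalculus.divergence Vmix x = 0
  rw [divergence_eq_sum_three, (hasFDerivAt_Vmix x).fderiv]
  simp

/-- The witness is a datum of the typed (printed) class: smooth and divergence free. -/
theorem Vmix_isDatum : IsDatum Vmix := ⟨Vmix_contDiff, Vmix_divFree⟩

/-- The witness is not constant (`V(0) = ∂z`, `V(∂x) = ∂z + ∂y`). -/
theorem Vmix_not_const : ¬ IsConst Vmix := by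
  rintro ⟨c, hc⟩
  have h : Vmix 0 1 = Vmix (bv 0) 1 := by rw [hc 0, hc (bv 0)]
  have hχ : (cut : ℝ → ℝ) 0 = 1 := cut_eq_one (by simp)
  simp [Vmix, hχ] at h

/-- Inside the slab `|z| < 1` the witness is the affine field `∂z + J x`. -/
theorem Vmix_eventuallyEq_affine {p : E3} (hp : |p 2| < 1) :
    Vmix =ᶠ[𝓝 p] fun y => bv 2 + Jrot y := by
  have ho : IsOpen {y : E3 | |y 2| < 1} :=
    isOpen_lt (continuous_abs.comp (pz : E3 →L[ℝ] ℝ).continuous) continuous_const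
  filter_upwards [ho.mem_nhds hp] with y hy
  simp [Vmix, cut_eq_one (le_of_lt hy)]

/-- Hence `∇V = J` inside the slab `|z| < 1` (rank 2 there). -/
theorem fderiv_Vmix_of_small {p : E3} (hp : |p 2| < 1) : fderiv ℝ Vmix p = Jrot := by
  rw [(Vmix_eventuallyEq_affine hp).fderiv_eq]
  exact (((Jrot : E3 →L[ℝ] E3).hasFDerivAt).const_add (bv 2)).fderiv

/-- Above the slab, `z > 2`, the witness is the constant stream `∂z`. -/
theorem Vmix_eventuallyEq_const {p : E3} (hp : 2 < p 2) :
    Vmix =ᶠ[𝓝 p] fun _ => bv 2 := by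
  have ho : IsOpen {y : E3 | 2 < y 2} := isOpen_lt continuous_const (pz : E3 →L[ℝ] ℝ).continuous
  filter_upwards [ho.mem_nhds hp] with y hy
  have : (cut : ℝ → ℝ) (y 2) = 0 := cut_eq_zero (by rw [abs_of_pos (by linarith)]; exact hy.le)
  simp [Vmix, this]

/-- Hence `∇V = 0` on the open half-space `{z > 2}` (rank 0 there). -/
theorem fderiv_Vmix_of_large {p : E3} (hp : 2 < p 2) : fderiv ℝ Vmix p = 0 := by
  rw [(Vmix_eventuallyEq_const hp).fderiv_eq]
  exact fderiv_const_apply _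

/-- **The witness is not «rank 2 on an open dense set»**: every dense set meets the open half-space
`{z > 2}`, where `rank ∇V = 0`. -/
theorem Vmix_not_rank2 : ¬ IsRank2 Vmix := by
  rintro ⟨S, -, hSd, hS⟩
  have ho : IsOpen {y : E3 | 2 < y 2} := isOpen_lt continuous_const (pz : E3 →L[ℝ] ℝ).continuous
  have hne : ({y : E3 | 2 < y 2}).Nonempty := ⟨(3 : ℝ) • bv 2, by simp; norm_num⟩
  obtain ⟨y, hyS, hy⟩ := hSd.exists_mem_open ho hne
  have hy' : 2 < y 2 := hy
  have h := hS y hyS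
  unfold jacRank at h
  rw [fderiv_Vmix_of_large hy', ContinuousLinearMap.toLinearMap_zero, LinearMap.range_zero,
    finrank_bot] at h
  exact absurd h (by norm_num)

/-- **Key identity for the printed rank-1 form**: if `W = α u` with `α`, `u` smooth and `(u·∇)u = 0`
(straight integral curves, Remark 2.2 p.10 l.41–42), then the convective derivative `(W·∇)W` is a multiple of
`u`: `(W·∇)W = (∇α · W) u`. -/
theorem convect_parallel {W : E3 → E3} {α : E3 → ℝ} {u : E3 → E3} (hα : ContDiff ℝ ∞ α)
    (hu : ContDiff ℝ ∞ u) (hstraight : ∀ x, fderiv ℝ u x (u x) = 0)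
    (hW : ∀ x, W x = α x • u x) (x : E3) :
    fderiv ℝ W x (W x) = (fderiv ℝ α x (W x)) • u x := by
  have hWf : W = fun y => α y • u y := funext hW
  have hαd : DifferentiableAt ℝ α x := (hα.differentiable (by simp)).differentiableAt
  have hud : DifferentiableAt ℝ u x := (hu.differentiable (by simp)).differentiableAt
  have hd : HasFDerivAt W (α x • fderiv ℝ u x + (fderiv ℝ α x).smulRight (u x)) x := by
    rw [hWf]; exact hαd.hasFDerivAt.smul hud.hasFDerivAt
  rw [hd.fderiv]
  simp only [add_apply, smul_apply,
    ContinuousLinearMap.smulRight_apply]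
  rw [hW x, map_smul, hstraight x, smul_zero, smul_zero, zero_add]

/-- **The witness is not of the printed rank-1 form** `V = α e`, `‖e‖ = 1`, `(e·∇)e = 0`: at `p = ½ ∂x`
(inside the slab) `(V·∇)V = J (V p) = −½ ∂x`, which is not a multiple of `e(p) ∥ V(p) = ∂z + ½ ∂y`. -/
theorem Vmix_not_rank1Form : ¬ IsRank1Form Vmix := by
  rintro ⟨α, u, hα, hu, -, hstraight, hV⟩
  set p : E3 := (1/2 : ℝ) • bv 0 with hp
  have hp2 : |p 2| < 1 := by simp [hp]
  have key := convect_parallel hα hu hstraight hV p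
  rw [fderiv_Vmix_of_small hp2] at key
  have h0 := congrArg (fun v : E3 => v 0) key
  have h2 := congrArg (fun v : E3 => v 2) key
  have hχ : (cut : ℝ → ℝ) 0 = 1 := cut_eq_one (by simp)
  have hVp : Vmix p = bv 2 + (1/2 : ℝ) • bv 1 := by
    simp [Vmix, hp, hχ, Jrot_apply]
  simp only [hVp] at h0 h2
  simp [Jrot_apply] at h0 h2
  have hup2 : u p 2 ≠ 0 := by
    intro hz
    have := congrArg (fun v : E3 => v 2) (hV p)
    simp [Vmix_apply_two, hz] at this
  have hc : fderiv ℝ α p (bv 2) + 2⁻¹ * fderiv ℝ α p (bv 1) = 0 := by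
    rcases h2 with h | h
    · exact h
    · exact absurd h hup2
  rw [hc] at h0
  simp at h0

/-! ## The refutation of binder 1 (`Step_C23` = Cor 2.3 p.10 l.44–46, VERBATIM) -/

/-- **Corollary 2.3 as typed is false**: the witness `Vmix` is a smooth divergence-free field, not of the
form `αe` with `e·∇e = 0`, not constant, and `rank ∇V = 2` holds on no open dense subset of ℝ³.
[cite: Vukolov2026, Cor 2.3 p.10 l.44–46; Thm 9.6 proof p.34 l.10–11] -/
theorem not_Step_C23 : ¬ Step_C23 := fun h =>
  Vmix_not_rank2 (h Vmix Vmix_isDatum Vmix_not_rank1Form Vmix_not_const)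

/-- **The printed three cases are not exhaustive on the typed data class**: a smooth divergence-free field
that is neither of the rank-1 form, nor constant, nor rank 2 on an open dense set.
[cite: Vukolov2026, Thm 9.6 proof p.34 l.10–11; Thm 2.1 p.10 l.31–40] -/
theorem cases_not_exhaustive :
    ∃ V : E3 → E3, IsDatum V ∧ ¬ IsRank1Form V ∧ ¬ IsConst V ∧ ¬ IsRank2 V :=
  ⟨Vmix, Vmix_isDatum, Vmix_not_rank1Form, Vmix_not_const, Vmix_not_rank2⟩

/-! ## The charitable re-typing: Theorem 2.1's hypothesis «det(∇V) ≡ 0» restored (refuter-typed) -/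

/-- The range of `∇V(x)` lies in the horizontal plane `span {∂x, ∂y}` at every point. -/
theorem range_fderiv_Vmix_le (x : E3) :
    LinearMap.range (fderiv ℝ Vmix x).toLinearMap ≤ Submodule.span ℝ ({bv 0, bv 1} : Set E3) := by
  rintro w ⟨v, rfl⟩
  rw [(hasFDerivAt_Vmix x).fderiv]
  simp only [ContinuousLinearMap.coe_coe, add_apply, smul_apply,
    ContinuousLinearMap.smulRight_apply]
  exact Submodule.add_mem _ (Submodule.smul_mem _ _ (Jrot_mem_span v))
    (Submodule.smul_mem _ _ (Jrot_mem_span x))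

/-- **`rank ∇V ≤ 2` everywhere** for the witness — in ℝ³ this is «det(∇V) ≡ 0», the standing hypothesis of
Theorem 2.1 p.10 l.31–34 from which Cor 2.3 is drawn. -/
theorem Vmix_jacRank_le_two (x : E3) : jacRank Vmix x ≤ 2 := by
  unfold jacRank
  calc Module.finrank ℝ (LinearMap.range (fderiv ℝ Vmix x).toLinearMap)
      ≤ Module.finrank ℝ (Submodule.span ℝ ({bv 0, bv 1} : Set E3)) :=
        Submodule.finrank_mono (range_fderiv_Vmix_le x)
    _ ≤ ({bv 0, bv 1} : Finset E3).card := by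
        rw [← Finset.coe_pair]; exact finrank_span_finset_le_card _
    _ ≤ 2 := Finset.card_le_two

/-- The charitable variant is false too, by the same witness. [cite: Vukolov2026, Thm 2.1 p.10 l.31–34; Cor 2.3 p.10 l.44–46] -/
theorem not_Step_C23_rankLeTwo : ¬ Literature.Uncategorized.Step_C23_rankLeTwo := fun h =>
  Vmix_not_rank2 (h Vmix Vmix_isDatum Vmix_jacRank_le_two Vmix_not_rank1Form Vmix_not_const)

/-! ## Records for the lettering (no verdict implied) -/

/-- **Binder 2 unfolds to the claimed theorem on the rank-2 class** (Def 2.6 p.12 l.22–27 as typed: membership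
in `A` is the existence of a global classical solution in gauge dress, `inA_iff_globalSol`).
[cite: Vukolov2026, Thm 6.7 p.27 l.7–11; Def 2.6 p.12 l.22–27] -/
theorem step67_iff_claim_on_rank2 :
    Step_67 ↔ ∀ ν : ℝ, 0 < ν → ∀ V₀ : E3 → E3, IsDatum V₀ → IsRank2 V₀ →
      ∃ (V : ℝ → E3 → E3) (P : ℝ → E3 → ℝ), IsClassicalNSSolutionOn (Ici 0) ν 0 V P ∧ V 0 = V₀ :=
  ⟨fun h ν hν V₀ hd hr => inA_iff_globalSol.1 (h ν hν V₀ hd hr),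
    fun h ν hν V₀ hd hr => inA_iff_globalSol.2 (h ν hν V₀ hd hr)⟩

/-- **Binder 3 unfolds to the claimed theorem on the rank-1 class** (Thm 9.4 p.33 l.62–75; Def 2.6 as typed).
[cite: Vukolov2026, Thm 9.4 p.33 l.62–75; Def 2.6 p.12 l.22–27] -/
theorem step94_iff_claim_on_rank1 :
    Step_94 ↔ ∀ ν : ℝ, 0 < ν → ∀ V₀ : E3 → E3, IsDatum V₀ → IsRank1Form V₀ →
      ∃ (V : ℝ → E3 → E3) (P : ℝ → E3 → ℝ), IsClassicalNSSolutionOn (Ici 0) ν 0 V P ∧ V 0 = V₀ :=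
  ⟨fun h ν hν V₀ hd hr => inA_iff_globalSol.1 (h ν hν V₀ hd hr),
    fun h ν hν V₀ hd hr => inA_iff_globalSol.2 (h ν hν V₀ hd hr)⟩

/-- The skeleton's route-5b certificate, re-exported by name (Thm 9.6 as typed ⇔ the claimed theorem).
[cite: Vukolov2026, Thm 9.6 p.34 l.7–11; Def 2.6 p.12 l.22–27] -/
theorem step96_iff_claimedTheorem' : Step_96 ↔ ClaimedTheorem := step96_iff_claimedTheorem

/-! ## On-path and fully-qualified-name guards -/

/-- ON PATH: the composition of record with binder 4 discharged consumes `Step_C23` first. -/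
example (hC23 : Step_C23) (h67 : Step_67) (h94 : Step_94) : ClaimedTheorem := claim_of_steps₃ hC23 h67 h94

/-- FQN guard: the refuted declaration is the landed binder. -/
example : ¬ Literature.Claims.NS.Vukolov2026.Step_C23 := not_Step_C23

/-- FQN guard: the witness is a datum of the landed class and outside all three landed case predicates. -/
example : Literature.Claims.NS.Vukolov2026.IsDatum Vmix ∧
    ¬ Literature.Claims.NS.Vukolov2026.IsRank1Form Vmix ∧ ¬ Literature.Claims.NS.Vukolov2026.IsConst Vmix ∧
      ¬ Literature.Claims.NS.Vukolov2026.IsRank2 Vmix :=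
  ⟨Vmix_isDatum, Vmix_not_rank1Form, Vmix_not_const, Vmix_not_rank2⟩

end Summit.NavierStokesRegularity.NavierStokesRegularity.Theorems.Vukolov2026

end
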